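import Literature.Computability.FineGrained.CompactionMachine
import Literature.Computability.FineGrained.CliqueETHTMBridge
import HarnessLib

/-!
# Padding the number of variables of a `k`-CNF is linear time on multi-stack machines

A small machine gadget for the change of machine model in the NSETH non-reducibility chain
(`NSETHNonReducibility.lean`): the map `KCNF.padVars N` — the same clauses on `numVars + N`
variables (the `N` new variables occur nowhere; satisfiability is unchanged) — is computed from
`KCNF.encode` to `KCNF.encode` by a multi-stack Turing machine in time linear in the input length
plus `O_N(n)` for the binary additions. The simulating machine of that chain hands the word RAM a
clause list on `n + N` variables, `N` a constant making every sparse `k`-CNF an instance of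
`CNFSATWithSize 2`; doing the padding in a first Turing-machine stage keeps the later stages free of
arithmetic on the header.

The program is a structured stack program over the alphabet `Γ'` of the encoding
(`Literature.Computability.Complexity.ACom`, `SymbolPrograms.lean`), on the register file and with
the binary increment `Compaction.incr` of `CompactionMachine.lean`: one pass over the input
`bits n ++ comma :: wFam clauses` — the header digits are collected, at the comma the numeral is
incremented `N` times and emitted with the comma, and the clause word is copied — accumulating the
output reversed on `acc` and pouring it onto `out` at the end (`PadVars.prog`, `PadVars.runs_prog`,
`computesInTime_padVars`).

## References

* S. Arora, B. Barak, *Computational Complexity: A Modern Approach*, CUP 2009, §1.3 (multi-tape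
  machine constructions).
* D. E. Knuth, *The Art of Computer Programming*, vol. 2, 3rd ed., Addison-Wesley 1997, §4.3.1
  (addition with carry; the increment).
-/

namespace Literature.Computability.FineGrained

open _root_.Computability Complexity Complexity.ACom Sparsifier Compaction

/-! ### Padding the number of variables -/

namespace KCNF

variable {k : ℕ}

/-- `φ.padVars N`: the `k`-CNF with the same clauses on `numVars + N` variables (the `N` added
variables `x_n, …, x_{n+N-1}` do not occur). [folklore] -/
def padVars (N : ℕ) (φ : KCNF k) : KCNF k where
  numVars := φ.numVars + N
  clauses := φ.clauses
  fst_lt_numVars c hc l hl := Nat.lt_add_right N (φ.fst_lt_numVars c hc l hl)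
  length_le := φ.length_le

/-- The padded formula has `n + N` variables. [folklore] -/
@[simp] theorem numVars_padVars (N : ℕ) (φ : KCNF k) : (φ.padVars N).numVars = φ.numVars + N := rfl

/-- The padded formula has the same clauses. [folklore] -/
@[simp] theorem clauses_padVars (N : ℕ) (φ : KCNF k) : (φ.padVars N).clauses = φ.clauses := rfl

/-- Padding does not change the value under a total assignment. [folklore] -/
theorem eval_padVars (N : ℕ) (φ : KCNF k) (v : ℕ → Bool) : (φ.padVars N).eval v = φ.eval v := rfl

/-- Padding does not change satisfiability. [folklore] -/
theorem satisfiable_padVars_iff (N : ℕ) (φ : KCNF k) : (φ.padVars N).Satisfiable ↔ φ.Satisfiable := by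
  rw [satisfiable_iff_exists_eval, satisfiable_iff_exists_eval]
  rfl

/-- The encoding of the padded formula: the numeral of `n + N`, the comma, the same clause word.
[folklore] -/
theorem encode_padVars (N : ℕ) (φ : KCNF k) :
    (φ.padVars N).encode = bits (φ.numVars + N) ++ Γ'.comma :: wFam φ.clauses := rfl

/-- The encoding of a formula: numeral, comma, clause word. [folklore] -/
theorem encode_eq_bits_wFam (φ : KCNF k) : φ.encode = bits φ.numVars ++ Γ'.comma :: wFam φ.clauses := rfl

end KCNF

namespace PadVars

/-! ### The program -/

/-- `N` increments of the numeral in `cnt`. [folklore] -/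
def incrN : ℕ → Prog
  | 0 => skip
  | N + 1 => incr ;; incrN N

/-- The action on a symbol of the header phase: a digit is collected on `j2`; at the comma the
numeral is restored on `cnt`, incremented `N` times, emitted (reversed) on `acc` with the comma,
and the phase flag `hdr` is raised. [folklore] -/
def hdrAct (N : ℕ) : Γ' → Prog
  | Γ'.bit b => push K.j2 (Γ'.bit b)
  | Γ'.comma => (((pour K.j2 K.cnt ;; incrN N) ;; pour K.cnt K.acc) ;; push K.acc Γ'.comma) ;;
      push K.hdr Γ'.blank
  | _ => skip

/-- The loop body: header phase while `hdr` is empty, copy phase afterwards. [folklore] -/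
def body (N : ℕ) (a : Γ') : Prog :=
  ifTop K.hdr fun o => match o with
    | none => hdrAct N a
    | some _ => push K.acc a

/-- The whole program: one pass over the input, lower the flag, pour the reversed output.
[folklore] -/
def prog (N : ℕ) : Prog := (loop K.inp (body N) ;; clear K.hdr) ;; pour K.acc K.out

/-! ### Stores -/

/-- The stores of the program: input, collected header digits, phase flag, numeral, reversed
output, output; every other register empty. [folklore] -/
def st (inp j2 hdr cnt acc out : List Γ') : Store := fun r =>
  match r with
  | K.inp => inp
  | K.j2 => j2
  | K.hdr => hdr
  | K.cnt => cnt
  | K.acc => acc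
  | K.out => out
  | _ => []

/-- A field of the store. [folklore] -/
@[simp] theorem st_inp (inp j2 hdr cnt acc out : List Γ') : st inp j2 hdr cnt acc out K.inp = inp := rfl
/-- A field of the store. [folklore] -/
@[simp] theorem st_j2 (inp j2 hdr cnt acc out : List Γ') : st inp j2 hdr cnt acc out K.j2 = j2 := rfl
/-- A field of the store. [folklore] -/
@[simp] theorem st_hdr (inp j2 hdr cnt acc out : List Γ') : st inp j2 hdr cnt acc out K.hdr = hdr := rfl
/-- A field of the store. [folklore] -/
@[simp] theorem st_cnt (inp j2 hdr cnt acc out : List Γ') : st inp j2 hdr cnt acc out K.cnt = cnt := rfl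
/-- A field of the store. [folklore] -/
@[simp] theorem st_acc (inp j2 hdr cnt acc out : List Γ') : st inp j2 hdr cnt acc out K.acc = acc := rfl
/-- A field of the store. [folklore] -/
@[simp] theorem st_out (inp j2 hdr cnt acc out : List Γ') : st inp j2 hdr cnt acc out K.out = out := rfl
/-- A field of the store. [folklore] -/
@[simp] theorem st_fl (inp j2 hdr cnt acc out : List Γ') : st inp j2 hdr cnt acc out K.fl = [] := rfl
/-- A field of the store. [folklore] -/
@[simp] theorem st_j1 (inp j2 hdr cnt acc out : List Γ') : st inp j2 hdr cnt acc out K.j1 = [] := rfl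

/-- Updating a field of the store. [folklore] -/
@[simp] theorem update_st_inp (inp j2 hdr cnt acc out v : List Γ') :
    Function.update (st inp j2 hdr cnt acc out) K.inp v = st v j2 hdr cnt acc out := by
  funext r; cases r <;> rfl
/-- Updating a field of the store. [folklore] -/
@[simp] theorem update_st_j2 (inp j2 hdr cnt acc out v : List Γ') :
    Function.update (st inp j2 hdr cnt acc out) K.j2 v = st inp v hdr cnt acc out := by
  funext r; cases r <;> rfl
/-- Updating a field of the store. [folklore] -/
@[simp] theorem update_st_hdr (inp j2 hdr cnt acc out v : List Γ') :
    Function.update (st inp j2 hdr cnt acc out) K.hdr v = st inp j2 v cnt acc out := by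
  funext r; cases r <;> rfl
/-- Updating a field of the store. [folklore] -/
@[simp] theorem update_st_cnt (inp j2 hdr cnt acc out v : List Γ') :
    Function.update (st inp j2 hdr cnt acc out) K.cnt v = st inp j2 hdr v acc out := by
  funext r; cases r <;> rfl
/-- Updating a field of the store. [folklore] -/
@[simp] theorem update_st_acc (inp j2 hdr cnt acc out v : List Γ') :
    Function.update (st inp j2 hdr cnt acc out) K.acc v = st inp j2 hdr cnt v out := by
  funext r; cases r <;> rfl
/-- Updating a field of the store. [folklore] -/
@[simp] theorem update_st_out (inp j2 hdr cnt acc out v : List Γ') :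
    Function.update (st inp j2 hdr cnt acc out) K.out v = st inp j2 hdr cnt acc v := by
  funext r; cases r <;> rfl

/-- The initial store is the input store. [folklore] -/
theorem single_inp (z : List Γ') : AStore.single K.inp z = st z [] [] [] [] [] := by
  funext r; cases r <;> simp [AStore.single, st]

/-- The final store is the output store. [folklore] -/
theorem single_out (z : List Γ') : AStore.single K.out z = st [] [] [] [] [] z := by
  funext r; cases r <;> simp [AStore.single, st]

/-! ### The routines -/

/-- `incrN N` on a numeral: `bits n ↦ bits (n + N)`, within `N · (9 (n + N) + 9)`. [folklore] -/
theorem runs_incrN : ∀ (N n : ℕ) (inp j2 hdr acc out : List Γ'),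
    Runs (incrN N) (st inp j2 hdr (bits n) acc out) (st inp j2 hdr (bits (n + N)) acc out)
      (N * (9 * (n + N) + 9))
  | 0, n, inp, j2, hdr, acc, out => (Runs.skip _).of_eq (by simp) (by simp)
  | N + 1, n, inp, j2, hdr, acc, out => by
    have h1 := runs_incr_bits n (st inp j2 hdr (bits n) acc out) rfl rfl rfl
    rw [update_st_cnt] at h1
    have h2 := runs_incrN N (n + 1) inp j2 hdr acc out
    rw [show n + 1 + N = n + (N + 1) by omega] at h2
    refine (h1.seq h2).of_eq rfl ?_
    have : N * (9 * (n + 1 + N) + 9) ≤ N * (9 * (n + (N + 1)) + 9) := le_of_eq (by ring_nf)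
    nlinarith

/-- The header segment: the digits are collected (reversed) on `j2`, `5` steps each. [folklore] -/
theorem seg_bits (N : ℕ) : ∀ (bs : List Bool) (done v : List Γ'),
    SegRuns K.inp (body N) (bw bs) (st (bw bs ++ v) done [] [] [] [])
      (st v ((bw bs).reverse ++ done) [] [] [] []) (5 * bs.length)
  | [], done, v => by simpa using SegRuns.nil K.inp (body N) (st v done [] [] [] [])
  | b :: bs, done, v => by
    have hk : st (bw (b :: bs) ++ v) done [] [] [] [] K.inp = Γ'.bit b :: (bw bs ++ v) := rfl
    have hb : Runs (body N (Γ'.bit b)) (st (bw bs ++ v) done [] [] [] [])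
        (st (bw bs ++ v) (Γ'.bit b :: done) [] [] [] []) 3 := by
      refine (Runs.ifTop_nil rfl ?_)
      exact Runs.push' (by rw [st_j2, update_st_j2])
    have ih := seg_bits N bs (Γ'.bit b :: done) v
    have := SegRuns.cons hk (by rw [update_st_inp]; exact hb) ih
    refine this.of_eq (by simp) (by simp; omega)

/-- The copy segment: with the flag raised, every symbol goes onto `acc`, `6` steps each.
[folklore] -/
theorem seg_copy (N : ℕ) (cnt : List Γ') : ∀ (u v done : List Γ'),
    SegRuns K.inp (body N) u (st (u ++ v) [] [Γ'.blank] cnt done [])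
      (st v [] [Γ'.blank] cnt (u.reverse ++ done) []) (6 * u.length) := by
  intro u v done
  have h := segRuns_inv (k := K.inp) (f := body N)
    (fun done rest => st rest [] [Γ'.blank] cnt done []) (fun _ _ => True) 4
    (fun _ _ _ => rfl)
    (fun done a rest _ => ⟨trivial, by
      rw [update_st_inp]
      refine Runs.ifTop_cons (x := Γ'.blank) (w := []) rfl ?_
      exact Runs.push' (by rw [st_acc, update_st_acc])⟩)
    u v done trivial
  exact h.of_eq rfl (by omega)

/-- The comma step: restore the numeral, add `N`, emit it reversed with the comma, raise the flag.
[folklore] -/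
theorem runs_body_comma (N n : ℕ) (v : List Γ') :
    Runs (body N Γ'.comma) (st v (bits n).reverse [] [] [] [])
      (st v [] [Γ'.blank] [] (Γ'.comma :: (bits (n + N)).reverse) [])
      (3 * (bits n).length + 1 + N * (9 * (n + N) + 9) + (3 * (bits (n + N)).length + 1) + 1 + 1 + 2) := by
  refine Runs.ifTop_nil rfl ?_
  show Runs (hdrAct N Γ'.comma) _ _ _
  unfold hdrAct
  have e1 := runs_pour (a := K.j2) (b := K.cnt) (by decide) (st v (bits n).reverse [] [] [] [])
  simp only [st_j2, st_cnt, List.length_reverse, List.reverse_reverse, List.append_nil, update_st_j2,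
    update_st_cnt] at e1
  have e2 := runs_incrN N n v [] [] [] []
  have e3 := runs_pour (a := K.cnt) (b := K.acc) (by decide) (st v [] [] (bits (n + N)) [] [])
  simp only [st_cnt, st_acc, List.append_nil, update_st_cnt, update_st_acc] at e3
  have e4 : Runs (push K.acc Γ'.comma) (st v [] [] [] (bits (n + N)).reverse [])
      (st v [] [] [] (Γ'.comma :: (bits (n + N)).reverse) []) 1 :=
    Runs.push' (by rw [st_acc, update_st_acc])
  have e5 : Runs (push K.hdr Γ'.blank) (st v [] [] [] (Γ'.comma :: (bits (n + N)).reverse) [])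
      (st v [] [Γ'.blank] [] (Γ'.comma :: (bits (n + N)).reverse) []) 1 :=
    Runs.push' (by rw [st_hdr, update_st_hdr])
  exact (((e1.seq e2).seq e3).seq e4).seq e5

/-- The cost of the program on a formula with `n` variables, `ℓ` header digits, `ℓ'` digits of
`n + N` and a clause word of length `w`. [folklore] -/
def cost (N n ℓ ℓ' w : ℕ) : ℕ :=
  5 * ℓ + (3 * ℓ + 1 + N * (9 * (n + N) + 9) + (3 * ℓ' + 1) + 1 + 1 + 2 + 2) + 6 * w + 1 + 3 +
    (3 * (w + 1 + ℓ') + 1)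

/-- **The program on a `k`-CNF**: from the input store on `φ.encode` to the output store on
`(φ.padVars N).encode`, within `cost`. [folklore] -/
theorem runs_prog {k : ℕ} (N : ℕ) (φ : KCNF k) :
    Runs (prog N) (AStore.single K.inp φ.encode) (AStore.single K.out (φ.padVars N).encode)
      (cost N φ.numVars (bits φ.numVars).length (bits (φ.numVars + N)).length (wFam φ.clauses).length) := by
  set n := φ.numVars with hn
  set W := wFam φ.clauses with hW
  rw [single_inp, single_out, KCNF.encode_eq_bits_wFam, KCNF.encode_padVars, ← hn, ← hW]
  -- the loop: header digits, comma, clause word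
  have s1 := seg_bits N (encodeNat n) [] (Γ'.comma :: W)
  rw [List.append_nil] at s1
  change SegRuns K.inp (body N) (bits n) (st (bits n ++ Γ'.comma :: W) [] [] [] [] [])
    (st (Γ'.comma :: W) (bits n).reverse [] [] [] []) (5 * (encodeNat n).length) at s1
  have s2 := runs_body_comma N n W
  have s3 := seg_copy N [] W [] (Γ'.comma :: (bits (n + N)).reverse)
  rw [List.append_nil] at s3
  have hk2 : st (Γ'.comma :: W) (bits n).reverse [] [] [] [] K.inp = Γ'.comma :: W := rfl
  have s23 := SegRuns.cons hk2 (by rw [update_st_inp]; exact s2) s3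
  have sall := s1.append s23
  have hloop := sall.runs_loop_nil (by rfl)
  -- lower the flag, pour the output
  have c1 := runs_clear K.hdr (st [] [] [Γ'.blank] [] (W.reverse ++ Γ'.comma :: (bits (n + N)).reverse) [])
  simp only [st_hdr, List.length_singleton, update_st_hdr] at c1
  have c2 := runs_pour (a := K.acc) (b := K.out) (by decide)
    (st [] [] [] [] (W.reverse ++ Γ'.comma :: (bits (n + N)).reverse) [])
  simp only [st_acc, st_out, List.append_nil, update_st_acc, update_st_out, List.length_append,
    List.length_reverse, List.length_cons, List.reverse_append, List.reverse_cons, List.reverse_reverse,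
    List.append_assoc, List.singleton_append] at c2
  refine ((hloop.seq c1).seq c2).of_eq ?_ ?_
  · simp
  · have hb : (bits n).length = (encodeNat n).length := by simp [bits]
    simp only [cost, hb]
    omega

/-- `cost` is at most linear in the lengths plus the additions. [folklore] -/
theorem cost_le (N n ℓ ℓ' w : ℕ) (hℓ' : ℓ' ≤ ℓ + N) :
    cost N n ℓ ℓ' w ≤ 20 * (ℓ + w + N + 1) + N * (9 * (n + N) + 9) := by
  unfold cost
  nlinarith

/-- The numeral of `n + N` has at most `N` more digits than that of `n`. [folklore] -/
theorem length_bits_add_le (n N : ℕ) : (bits (n + N)).length ≤ (bits n).length + N := by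
  induction N with
  | zero => simp
  | succ N ih =>
    have h := TokConv.length_incRes_le true (encodeNat (n + N))
    rw [← TokConv.encodeNat_succ_eq_incRes] at h
    simp only [bits, List.length_map] at ih ⊢
    rw [show n + (N + 1) = n + N + 1 by omega]
    omega

end PadVars

/-- **Padding the number of variables is computable in linear time plus `O_N(n)`**: some
multi-stack machine maps `φ.encode` to `(φ.padVars N).encode` within
`20 (L + N + 1) + N (9 (n + N) + 9) + 1` steps (`L = |φ.encode|`, `n = numVars φ`).
[cite: AroraBarak2009, §1.3 (multi-tape machine constructions)] -/
theorem computesInTime_padVars (k N : ℕ) :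
    ComputesInTime KCNF.encode KCNF.encode (fun φ : KCNF k => φ.padVars N)
      fun φ => 20 * (φ.encode.length + N + 1) + N * (9 * (φ.numVars + N) + 9) + 1 := by
  obtain ⟨M, hM⟩ := ACom.exists_computesInTime (PadVars.prog N) K.inp K.out KCNF.encode KCNF.encode
    (fun φ : KCNF k => φ.padVars N)
    (fun φ => PadVars.cost N φ.numVars (bits φ.numVars).length (bits (φ.numVars + N)).length
      (wFam φ.clauses).length)
    (fun φ => PadVars.runs_prog N φ)
  refine ⟨M, fun φ => ?_⟩
  obtain ⟨h⟩ := hM φ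
  refine ⟨⟨h.toEvalsTo, h.steps_le_m.trans (Nat.succ_le_succ ?_)⟩⟩
  have hL : φ.encode.length = (bits φ.numVars).length + (wFam φ.clauses).length + 1 := by
    rw [KCNF.encode_eq_bits_wFam]; simp; omega
  have := PadVars.cost_le N φ.numVars (bits φ.numVars).length (bits (φ.numVars + N)).length
    (wFam φ.clauses).length (PadVars.length_bits_add_le _ _)
  rw [hL]
  omega

end Literature.Computability.FineGrained
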